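import Literature.NumberTheory.EllipticCurves.ZpExtensionEisensteinReadoutUnramifiedProofs
import Literature.NumberTheory.EllipticCurves.IwasawaEisensteinTwistedRepH1TransportProofs
import Literature.NumberTheory.EllipticCurves.GoodReductionUnramifiedProofs
import Literature.NumberTheory.EllipticCurves.ZpExtensionUnramifiedProofs
import Literature.NumberTheory.EllipticCurves.IwasawaSelmerControlAwayFromPProofs
import Literature.NumberTheory.GaloisRepresentations.DecompositionGroupOfCompletion
import HarnessLib

/-!
# The CONVERSE readout at a good place `v ∤ p`: a class of `H¹(K, T^{(k)})` whose readout lies in a `conj_γ`-stable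
# family of classes unramified over `K_∞` at `v` is itself UNRAMIFIED at `v` (proofs file)

Topic `NumberTheory/EllipticCurves` (cell `pub/bsd-print-x9`, shared μ-crux `MuInequalityCoherentPairOfPrintCG`
stmt-BirchSwinnertonDyer-23428, clause (B5) `HeegnerMuPartControlGlue.Stmt.readoutIndex`, place-wise input «no contribution
at the good places» (`hoff` of `WeierstrassCurve.finite_and_natCard_kerPsi_quotient_eisensteinTowerReadout_le_of_local`);
seat `bsd-line-x9-p2` g6; sequel to `ZpExtensionEisensteinReadoutUnramifiedProofs` (the forward direction: the readout of an
unramified local class is unramified over `K_∞`) and `IwasawaEisensteinTwistedRepH1TransportProofs` (coordinate cocycles,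
shift relations)). THEOREMS ONLY; no definition, no named fact, no instance, no `sorry`.

For `E = W_K`, `H = ker κ = Gal(K̄/K_∞)`, `γ` a topological generator of `κ`, a finite place `v ∤ p` of GOOD reduction and
a class `[ξ] ∈ H¹(K, T^{(k)})` (`T^{(k)} = E[p^{k+1}] ⊗ A_{m,k+1}(ψ⁻¹)`):

* §1 `ZpExtension.oneCocycleClass_coord_mem_of_last_mem` (generic coefficients `M ⊗ A_{m,k}(χ)`, `χ γ · (1+T) = 1`) — if the
  LAST coordinate class `[φ_{m−1}] ∈ H¹(K_∞, M)` of a cocycle `ξ` lies in a `conj_γ`-stable subgroup `𝒮`, then EVERY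
  coordinate class `[φ_j]` does: `[φ_j] = (conj_γ − 1)^{m−1−j} [φ_{m−1}]` by the shift relations
  (`IwasawaDual.conjH1_oneCocycleClass_coord_eq`, `IwasawaDual.coord_eq_pow_sub_one_apply_last`).
* §2 **`WeierstrassCurve.localization_mem_unramifiedSubgroup_of_eisensteinTowerReadout_mem`** — if the readout of `[ξ]` in
  `H¹(K_∞, E[p^∞])` lies in a subgroup `𝒮` that is `conj_γ`-stable and whose members die on `H ⊓ I_v` (are unramified over
  `K_∞` at the place above `v`), then `loc_v [ξ] ∈ H¹_ur(K_v, T^{(k)})`.  Proof: the readout is `±ι_*[φ_{m−1}]`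
  (`eisensteinTwistLevelReadout_oneCocycleClass`), so by §1 (applied to `ι_*⁻¹ 𝒮`, `conj_γ`-stable by
  `resH1Hom_inclusion_conjH1`) every `ι_*[φ_j]` dies on `H ⊓ I_v`, i.e. `ι ∘ φ_j = ∂w_j` there; by Néron–Ogg–Shafarevich
  (`smul_eq_of_mem_inertia_of_nsmul_eq_zero`, AEC VII.4.1: `I_v` fixes `E[p^∞]` at a good `v ∤ p`) `∂w_j = 0`, so every
  coordinate `λ([π_j^*] ξ(τ))` vanishes for `τ ∈ I_{K_v}` (which restricts into `H`, `ℤ_p`-extensions being unramified at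
  `v ∤ p`, Washington 13.2 = `ZpExtension.inertia_le_kerSubgroup_holds`), hence `ξ(τ) = 0` (the tail form is perfect,
  `Twisted.eq_zero_of_forall_tailReadout_dualFamily_smul_eq_zero`) and `loc_v [ξ]` is principal on `I_{K_v}`.

With `𝒮 = Sel_{p^∞}(E/K_∞)` (`conj_γ`-stable; Kummer ⇒ locally trivial ⇒ unramified over `K_∞` at `v ∤ p`, Greenberg LNM 1716
Prop. 2.1 / GV p. 17, in the tree under `Summits/…/Rank1Residual/Additive`) this is the «no contribution at the good places»
input of Howard's Prop. 2.2.8 (second map) at `𝔮 = T^m + p` (Summits-side sequel). BSD is not proved by any of this.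

References: [Howard2004HeegnerKolyvagin] Def. 2.1.10, Lemma 2.2.7 / Prop. 2.2.8, proof of Thm. 2.2.10 (arXiv 1202.6340 p. 17
L41–53); [GreenbergLNM1716] §2 Prop. 2.1 (pp. 69–72), §4 pp. 107, 124; [SilvermanAEC2009] Prop. VII.4.1; [Washington1997] Prop. 13.2.
-/

noncomputable section

open scoped Classical ContRepresentation

open NumberField IsDedekindDomain Field
open Literature.NumberTheory.EllipticCurves Literature.NumberTheory.GaloisRepresentations
open Literature.NumberTheory.GaloisRepresentations.galoisCohomology
open Literature.NumberTheory.GaloisCohomology.Howard2004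
open Literature.NumberTheory.EllipticCurves.GreenbergSelmer
open CategoryTheory ContinuousCohomology IwasawaAlgebra IwasawaAlgebra.EisensteinCoeff IwasawaAlgebra.EisensteinCoeff.TwistedBy

universe u

/-! ## §1 Generic coefficients: a `conj_γ`-stable subgroup containing the last coordinate class contains them all -/

namespace Literature.NumberTheory.EllipticCurves

namespace ZpExtension

variable {K : Type u} [Field K] {p : ℕ} [Fact p.Prime] (κ : ZpExtension K p) {m : ℕ} (hm : 1 ≤ m) (k : ℕ)
  {M : Type u} [AddCommGroup M] [DistribMulAction (absoluteGaloisGroup K) M] [TopologicalSpace M] [DiscreteTopology M]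
  (χ : absoluteGaloisGroup K →* EisensteinCoeff p m k) (ρ : DiscreteGaloisModule K M)
  (hact : ∀ (σ : absoluteGaloisGroup K) (x : Twisted p m k M),
    κ.eisensteinTwist ρ hm k σ x = (ofTwisted χ M).symm (σ • ofTwisted χ M x))
  (κ₀ : ZpExtension K p) (hM : ∀ a : M, p ^ k • a = 0) (hχker : ∀ σ ∈ κ₀.kerSubgroup, χ σ = 1)

include hact hχker in
/-- **All coordinate classes lie in any `conj_γ`-stable subgroup containing the last one.** For a 1-cocycle `ξ` of
`M ⊗ A_{m,k}(χ)` (`χ = 1` on `ker κ₀`, `χ γ · (1+T) = 1`) with coordinate cocycles `φ_j(h) = λ_k([π_j^*] ξ(h))` on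
`Gal(K̄/K_∞)`, and a subgroup `𝒮 ≤ H¹(K_∞, M)` stable under `conj_γ`: if `[φ_{m−1}] ∈ 𝒮` then `[φ_j] ∈ 𝒮` for every `j < m`
— since `[φ_j] = (conj_γ − 1)^{m−1−j} [φ_{m−1}]` (shift relations).
[cite: Howard2004HeegnerKolyvagin, §2.2 and proof of Thm. 2.2.10 (𝔮 = T^m + p)] [cite: GreenbergLNM1716, §4 p. 107] -/
theorem oneCocycleClass_coord_mem_of_last_mem {γ : absoluteGaloisGroup K}
    (hχγ : χ γ * EisensteinCoeff.onePlusT p m k = 1)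
    (ξ : contOneCocycles (κ.eisensteinTwist ρ hm k).toTopRep)
    (φ : Fin m → contOneCocycles (discreteTopRep κ₀.kerSubgroup M))
    (hφ : ∀ (j : Fin m) (h : κ₀.kerSubgroup), (φ j).1 h =
      Twisted.tailReadout p hm k hM (EisensteinCoeff.dualFamily p hm k j • ξ.1 (h : absoluteGaloisGroup K)))
    (𝒮 : AddSubgroup (subgroupH1 κ₀.kerSubgroup M))
    (h𝒮 : ∀ s ∈ 𝒮, conjH1 κ₀.kerSubgroup M γ s ∈ 𝒮)
    (hlast : oneCocycleClass _ (φ ⟨m - 1, Nat.sub_lt (lt_of_lt_of_le zero_lt_one hm) zero_lt_one⟩) ∈ 𝒮)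
    (j : Fin m) : oneCocycleClass _ (φ j) ∈ 𝒮 := by
  have hlast' : m - 1 < m := Nat.sub_lt (lt_of_lt_of_le zero_lt_one hm) zero_lt_one
  have hf := κ.eisensteinTwist_contOneCocycles_apply_mul hm k χ ρ hact ξ
  -- `conj_γ` as an element of the endomorphism ring of `H¹(K_∞, M)`
  obtain ⟨θ, hθ⟩ : ∃ θ : AddMonoid.End (subgroupH1 κ₀.kerSubgroup M), ∀ c, θ c = conjH1 κ₀.kerSubgroup M γ c :=
    ⟨conjH1 κ₀.kerSubgroup M γ, fun _ ↦ rfl⟩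
  -- the shift relations `conj_γ [φ_j] = [φ_j] + [φ_{j-1}]`, `conj_γ [φ_0] = [φ_0] - p [φ_{m-1}]`
  have hrec : ∀ j : Fin m, θ (oneCocycleClass _ (φ j)) = oneCocycleClass _ (φ j) +
      (if (j : ℕ) = 0 then -(p • oneCocycleClass _ (φ ⟨m - 1, hlast'⟩))
        else oneCocycleClass _ (φ ⟨(j : ℕ) - 1, lt_of_le_of_lt (Nat.sub_le _ _) j.2⟩)) := fun j ↦ by
    rw [hθ]
    exact IwasawaDual.conjH1_oneCocycleClass_coord_eq κ₀ hm k hM χ (map_mul χ) hχker hχγ (fun σ ↦ ξ.1 σ) hf φ hφ j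
  -- `(conj_γ - 1)^d` preserves `𝒮`
  have hpow : ∀ (d : ℕ) (s : subgroupH1 κ₀.kerSubgroup M), s ∈ 𝒮 → ((θ - 1) ^ d) s ∈ 𝒮 := by
    intro d
    induction d with
    | zero =>
      intro s hs
      rw [pow_zero, AddMonoid.End.one_apply]
      exact hs
    | succ d ih =>
      intro s hs
      rw [pow_succ', show ∀ x, ((θ - 1) * (θ - 1) ^ d) x = (θ - 1) (((θ - 1) ^ d) x) from fun _ ↦ rfl,
        show ∀ x, (θ - 1) x = θ x - (1 : AddMonoid.End (subgroupH1 κ₀.kerSubgroup M)) x from fun _ ↦ rfl,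
        AddMonoid.End.one_apply, hθ]
      exact 𝒮.sub_mem (h𝒮 _ (ih s hs)) (ih s hs)
  have hd : m - 1 - (j : ℕ) < m := lt_of_le_of_lt (Nat.sub_le _ _) hlast'
  have key := IwasawaDual.coord_eq_pow_sub_one_apply_last (p := p) hm θ (fun j ↦ oneCocycleClass _ (φ j)) hrec hd
  have hidx : (⟨m - 1 - (m - 1 - (j : ℕ)), lt_of_le_of_lt (Nat.sub_le _ _) hlast'⟩ : Fin m) = j :=
    Fin.ext (by have := j.2; show m - 1 - (m - 1 - (j : ℕ)) = (j : ℕ); omega)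
  rw [hidx] at key
  rw [key]
  exact hpow _ _ hlast

end ZpExtension

end Literature.NumberTheory.EllipticCurves

/-! ## §2 The curve: readout in a `conj_γ`-stable family of `K_∞`-unramified classes ⇒ unramified at a good `v ∤ p` -/

namespace WeierstrassCurve

open Literature.NumberTheory.EllipticCurves.ZpExtension (EisensteinLevel)

variable {K : Type} [Field K] [NumberField K] (W : WeierstrassCurve ℚ) [W.IsElliptic] {p : ℕ} [hp : Fact p.Prime]
  (κ : ZpExtension K p) {m : ℕ} (hm : 1 ≤ m)

variable (π : IwasawaAlgebra p ⧸ Ideal.span {(PowerSeries.X ^ m + PowerSeries.C (p : ℤ_[p]) : IwasawaAlgebra p)})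
  (e : ℕ → ℕ)
  (hkill : letI := IwasawaAlgebra.isLocalRing_quotient_X_pow_add_C p hm
    ∀ k, ∀ r ∈ IsLocalRing.maximalIdeal
      (IwasawaAlgebra p ⧸ Ideal.span {(PowerSeries.X ^ m + PowerSeries.C (p : ℤ_[p]) : IwasawaAlgebra p)}) ^ e k,
      ∀ x : EisensteinLevel p m (fun j ↦ geomTorsion (W.baseChange K) ((p : ℤ) ^ j)) (k + 1), r • x = 0)
  (hker : letI := IwasawaAlgebra.isLocalRing_quotient_X_pow_add_C p hm
    ∀ k, LinearMap.ker ((W.eisensteinTower (κ.unitTwist (-1)) hm).red k) =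
      (IsLocalRing.maximalIdeal
        (IwasawaAlgebra p ⧸ Ideal.span {(PowerSeries.X ^ m + PowerSeries.C (p : ℤ_[p]) : IwasawaAlgebra p)}) ^ e k) •
        (⊤ : Submodule (IwasawaAlgebra p ⧸ Ideal.span {(PowerSeries.X ^ m + PowerSeries.C (p : ℤ_[p]) : IwasawaAlgebra p)})
          (EisensteinLevel p m (fun j ↦ geomTorsion (W.baseChange K) ((p : ℤ) ^ j)) (k + 1 + 1))))
  (hπ : letI := IwasawaAlgebra.isLocalRing_quotient_X_pow_add_C p hm
    π ∈ IsLocalRing.maximalIdeal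
      (IwasawaAlgebra p ⧸ Ideal.span {(PowerSeries.X ^ m + PowerSeries.C (p : ℤ_[p]) : IwasawaAlgebra p)}))
  (he : ∀ k, e k ≤ e (k + 1))
  (hπX : π = Ideal.Quotient.mk _ PowerSeries.X) (hek : ∀ k, e (k + 1) - e k = m)

/-- **The converse readout at a good place `v ∤ p`.** Let `γ` be a topological generator of `κ`, `v ∤ p` a finite place where
`E = W_K` has good reduction, and `𝒮 ≤ H¹(K_∞, E[p^∞])` a subgroup stable under `conj_γ` all of whose members restrict to `0`
in `H¹(H ⊓ I_v, E[p^∞])` (are unramified over `K_∞` at the place above `v`). If the readout of a class `c ∈ H¹(K, T^{(k)})`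
lies in `𝒮`, then `loc_v c ∈ H¹_ur(K_v, T^{(k)})`: all coordinate classes of `c` lie in `ι_*⁻¹ 𝒮` (§1), so every coordinate
cocycle is a coboundary of `E[p^∞]` on `H ⊓ I_v`, hence ZERO there (Néron–Ogg–Shafarevich: `I_v` fixes `E[p^∞]`); `I_{K_v}`
restricts into `H` (Washington 13.2), so the whole cocycle vanishes on `I_{K_v}` (the tail form is perfect).
[cite: Howard2004HeegnerKolyvagin, Def. 2.1.10 and Lemma 2.2.7 / Prop. 2.2.8 (arXiv p. 17 L41–53)] [cite: SilvermanAEC2009, Prop. VII.4.1]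
[cite: GreenbergLNM1716, §4 pp. 107, 124] [cite: Washington1997, Prop. 13.2] -/
theorem localization_mem_unramifiedSubgroup_of_eisensteinTowerReadout_mem {γ : absoluteGaloisGroup K}
    (hγ : κ.IsTopGenerator γ) (v : HeightOneSpectrum (𝓞 K)) (hpv : ((p : ℕ) : 𝓞 K) ∉ v.asIdeal)
    (hgood : (W.baseChange K).HasGoodReductionAt v)
    (𝒮 : AddSubgroup ((W.baseChange K).subgroupH1 p κ.kerSubgroup))
    (h𝒮γ : ∀ s ∈ 𝒮, (W.baseChange K).conjH1 p κ.kerSubgroup γ s ∈ 𝒮)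
    (h𝒮I : ∀ s ∈ 𝒮, resH1Hom (inertiaInToH κ.kerSubgroup v) (AddMonoidHom.id ((W.baseChange K).geomPrimaryTorsion p))
      (fun _ _ ↦ rfl) s = 0)
    (k : ℕ)
    (c : galoisCohomology
      ((κ.unitTwist (-1)).eisensteinTwist ((W.baseChange K).torsionGaloisModule ((p : ℤ) ^ (k + 1))) hm (k + 1)) 1)
    (hc : letI := IwasawaAlgebra.isLocalRing_quotient_X_pow_add_C p hm
      W.eisensteinTowerReadout κ hm π e hkill hker hπ he hπX hek
        (AddCommGroup.DirectLimit.of _ _ k c :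
          AdicTower.H1A (W.eisensteinTower (κ.unitTwist (-1)) hm) π e hkill hker hπ he) ∈ 𝒮) :
    galoisCohomology.localization
        ((κ.unitTwist (-1)).eisensteinTwist ((W.baseChange K).torsionGaloisModule ((p : ℤ) ^ (k + 1))) hm (k + 1))
        (Sum.inr v) 1 c ∈
      DiscreteGaloisModule.unramifiedSubgroup (GaloisRep.toLocal v
        ((κ.unitTwist (-1)).eisensteinTwist ((W.baseChange K).torsionGaloisModule ((p : ℤ) ^ (k + 1))) hm (k + 1))) 1 := by
  letI := IwasawaAlgebra.isLocalRing_quotient_X_pow_add_C p hm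
  obtain ⟨ξ, rfl⟩ := oneCocycleClass_surjective _ c
  have hlast : m - 1 < m := Nat.sub_lt (lt_of_lt_of_le zero_lt_one hm) zero_lt_one
  -- the coordinate cocycles of `ξ` on `H = ker κ`
  obtain ⟨φ, hφ⟩ := (κ.unitTwist (-1)).exists_coordCocycles hm (k + 1)
    ((κ.unitTwist (-1)).eisensteinTwistChar hm (k + 1)) ((W.baseChange K).torsionGaloisModule ((p : ℤ) ^ (k + 1)))
    (fun σ y ↦ (κ.unitTwist (-1)).eisensteinTwist_torsionGaloisModule_apply hm (k + 1) (W.baseChange K) _ σ y) κ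
    (fun b ↦ (W.baseChange K).geomTorsion_pow_nsmul_eq_zero p (k + 1) b)
    (fun _ hσ ↦ κ.eisensteinTwistChar_unitTwist_eq_one_of_mem_kerSubgroup hm (k + 1) (-1) hσ) ξ
  -- (1) the readout of `[ξ]` is `(-1)^k • ι_* [φ_{m-1}]`
  have hread : W.eisensteinTowerReadout κ hm π e hkill hker hπ he hπX hek
      (AddCommGroup.DirectLimit.of _ _ k (oneCocycleClass ((κ.unitTwist (-1)).eisensteinTwist
        ((W.baseChange K).torsionGaloisModule ((p : ℤ) ^ (k + 1))) hm (k + 1)).toTopRep ξ :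
          galoisCohomology ((κ.unitTwist (-1)).eisensteinTwist
            ((W.baseChange K).torsionGaloisModule ((p : ℤ) ^ (k + 1))) hm (k + 1)) 1) :
        AdicTower.H1A (W.eisensteinTower (κ.unitTwist (-1)) hm) π e hkill hker hπ he) =
      ((-1 : ℤ) ^ k) • resH1Hom (ContinuousMonoidHom.id κ.kerSubgroup)
        (AddSubgroup.inclusion (AcSigned.geomTorsion_zpow_le_geomPrimaryTorsion (W.baseChange K) p (k + 1)))
        (fun _ _ ↦ rfl) (oneCocycleClass _ (φ ⟨m - 1, hlast⟩)) := by
    rw [WeierstrassCurve.eisensteinTowerReadout, ZpExtension.eisensteinTowerReadout_of,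
      ZpExtension.eisensteinTowerLevelMap_apply,
      (κ.unitTwist (-1)).eisensteinTwistLevelReadout_oneCocycleClass hm (k + 1) _ _ _ κ _ _ ξ φ hφ]
  -- (2) the pulled-back family `ι_*⁻¹ 𝒮 ≤ H¹(K_∞, E[p^{k+1}])` is `conj_γ`-stable and contains `[φ_{m-1}]`
  have h𝒮M : ∀ s ∈ 𝒮.comap (resH1Hom (ContinuousMonoidHom.id κ.kerSubgroup)
      (AddSubgroup.inclusion (AcSigned.geomTorsion_zpow_le_geomPrimaryTorsion (W.baseChange K) p (k + 1)))
      (fun _ _ ↦ rfl)),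
      Literature.NumberTheory.EllipticCurves.conjH1 κ.kerSubgroup (geomTorsion (W.baseChange K) ((p : ℤ) ^ (k + 1))) γ s ∈
        𝒮.comap (resH1Hom (ContinuousMonoidHom.id κ.kerSubgroup)
          (AddSubgroup.inclusion (AcSigned.geomTorsion_zpow_le_geomPrimaryTorsion (W.baseChange K) p (k + 1)))
          (fun _ _ ↦ rfl)) := by
    intro s hs
    rw [AddSubgroup.mem_comap] at hs ⊢
    rw [W.resH1Hom_inclusion_conjH1 κ γ (k + 1)]
    exact h𝒮γ _ hs
  have hlastmem : oneCocycleClass _ (φ ⟨m - 1, hlast⟩) ∈ 𝒮.comap (resH1Hom (ContinuousMonoidHom.id κ.kerSubgroup)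
      (AddSubgroup.inclusion (AcSigned.geomTorsion_zpow_le_geomPrimaryTorsion (W.baseChange K) p (k + 1)))
      (fun _ _ ↦ rfl)) := by
    rw [AddSubgroup.mem_comap]
    have h2 := 𝒮.zsmul_mem hc ((-1 : ℤ) ^ k)
    rw [hread, smul_smul, ← mul_pow, neg_mul_neg, one_mul, one_pow, one_smul] at h2
    exact h2
  have hall := fun j ↦ (κ.unitTwist (-1)).oneCocycleClass_coord_mem_of_last_mem hm (k + 1)
    ((κ.unitTwist (-1)).eisensteinTwistChar hm (k + 1)) ((W.baseChange K).torsionGaloisModule ((p : ℤ) ^ (k + 1)))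
    (fun σ y ↦ (κ.unitTwist (-1)).eisensteinTwist_torsionGaloisModule_apply hm (k + 1) (W.baseChange K) _ σ y) κ
    (fun b ↦ (W.baseChange K).geomTorsion_pow_nsmul_eq_zero p (k + 1) b)
    (fun _ hσ ↦ κ.eisensteinTwistChar_unitTwist_eq_one_of_mem_kerSubgroup hm (k + 1) (-1) hσ)
    (κ.eisensteinTwistChar_unitTwist_neg_one_mul_onePlusT hm (k + 1) hγ) ξ φ hφ _ h𝒮M hlastmem j
  -- (3) `I_v ≤ ker κ` (Washington 13.2) and `I_v = I_{𝔓₀}` for the prime `𝔓₀` cut out by the chosen embedding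
  have hIeq : inertia v = (adicCompletionPrime K v).inertia (absoluteGaloisGroup K) :=
    (inertia_adicCompletionPrime_eq_map_absInertia K v).symm
  have hI : inertia v ≤ κ.kerSubgroup := by
    rw [hIeq]
    exact ZpExtension.inertia_le_kerSubgroup_holds K p κ hpv (adicCompletionPrime_mem_primesAbove K v)
  -- (4) every coordinate cocycle vanishes on `H ⊓ I_v` (principal there, and `I_v` fixes `E[p^∞]`)
  have hzero : ∀ (j : Fin m) (y : inertiaIn κ.kerSubgroup v), (φ j).1 (inertiaInToH κ.kerSubgroup v y) = 0 := by
    intro j y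
    have h1 := h𝒮I _ (hall j)
    rw [resH1Hom_oneCocycleClass, CocycleCriteria.resH1Hom_oneCocycleClass_eq_zero_iff] at h1
    obtain ⟨n, hn⟩ := h1
    have hy := hn y
    rw [pullback_resHomOfEquivariant_apply, AddMonoidHom.id_apply] at hy
    -- Néron–Ogg–Shafarevich: `y • n = n`
    have hyI : (((y : inertiaIn κ.kerSubgroup v) : decomp (K := K) v) : absoluteGaloisGroup K) ∈
        (adicCompletionPrime K v).inertia (absoluteGaloisGroup K) := by
      rw [← hIeq]; exact ((mem_inertiaIn_iff κ.kerSubgroup v _).1 y.2).2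
    obtain ⟨a, ha⟩ := (Literature.NumberTheory.EllipticCurves.PrimaryCoinvariants.mem_primaryComponent_iff_exists_nsmul p
      (n : geomPoints (W.baseChange K))).1 n.2
    have hyn : y • n = n := by
      apply Subtype.ext
      rw [show ((y • n : (W.baseChange K).geomPrimaryTorsion p) : geomPoints (W.baseChange K)) =
          (((y : inertiaIn κ.kerSubgroup v) : decomp (K := K) v) : absoluteGaloisGroup K) • (n : geomPoints (W.baseChange K))
          from rfl]
      exact (W.baseChange K).smul_eq_of_mem_inertia_of_nsmul_eq_zero hgood (v.natCast_pow_not_mem hpv a)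
        (adicCompletionPrime_mem_primesAbove K v) hyI ha
    rw [hyn, sub_self] at hy
    have hy' := congrArg (fun z : (W.baseChange K).geomPrimaryTorsion p ↦ (z : geomPoints (W.baseChange K))) hy
    simp only [AddSubgroup.coe_inclusion, ZeroMemClass.coe_zero] at hy'
    exact Subtype.ext hy'
  -- (5) hence `ξ` vanishes on `res(I_{K_v})`
  have hvan : ∀ τ : absoluteGaloisGroup (v.adicCompletion K), τ ∈ absInertia (v.adicCompletion K) →
      ξ.1 (absGaloisRestrict K (v.adicCompletion K) τ) = 0 := by
    intro τ hτ
    have hτI : absGaloisRestrict K (v.adicCompletion K) τ ∈ inertia v := Subgroup.mem_map_of_mem _ hτ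
    have hτD : absGaloisRestrict K (v.adicCompletion K) τ ∈ decomp (K := K) v := ⟨τ, rfl⟩
    have hτH : absGaloisRestrict K (v.adicCompletion K) τ ∈ κ.kerSubgroup := hI hτI
    let y : inertiaIn κ.kerSubgroup v := ⟨⟨_, hτD⟩, (mem_inertiaIn_iff κ.kerSubgroup v _).2 ⟨hτH, hτI⟩⟩
    apply Twisted.eq_zero_of_forall_tailReadout_dualFamily_smul_eq_zero p hm (k + 1)
      (fun b ↦ (W.baseChange K).geomTorsion_pow_nsmul_eq_zero p (k + 1) b)
    intro j
    have h := hzero j y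
    rw [hφ] at h
    exact h
  -- (6) `loc_v [ξ] = [ξ ∘ res]` is principal (`w₀ = 0`) on `I_{K_v}`
  obtain ⟨ξres, hξres, hξval⟩ : ∃ ξres : contOneCocycles
      (((κ.unitTwist (-1)).eisensteinTwist ((W.baseChange K).torsionGaloisModule ((p : ℤ) ^ (k + 1))) hm
        (k + 1)).toLocal (Sum.inr v : Place K)).toTopRep,
      oneCocycleClass _ ξres = galoisCohomology.localization
        ((κ.unitTwist (-1)).eisensteinTwist ((W.baseChange K).torsionGaloisModule ((p : ℤ) ^ (k + 1))) hm (k + 1))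
        (Sum.inr v) 1 (oneCocycleClass _ ξ) ∧
      ∀ τ : absoluteGaloisGroup (v.adicCompletion K), ξres.1 τ = ξ.1 (absGaloisRestrict K (v.adicCompletion K) τ) :=
    ⟨contOneCocycles.pullback (absGaloisRestrict K (Place.Completion (Sum.inr v : Place K)))
      (X := ((κ.unitTwist (-1)).eisensteinTwist ((W.baseChange K).torsionGaloisModule ((p : ℤ) ^ (k + 1))) hm
        (k + 1)).toTopRep)
      (Y := (((κ.unitTwist (-1)).eisensteinTwist ((W.baseChange K).torsionGaloisModule ((p : ℤ) ^ (k + 1))) hm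
        (k + 1)).toLocal (Sum.inr v : Place K)).toTopRep)
      (TopRep.ofHom ⟨ContinuousLinearMap.id ℤ _, fun _ ↦ rfl⟩) ξ,
     (galoisCohomology.pullback_one_oneCocycleClass _ _ ξ).symm, fun _ ↦ rfl⟩
  rw [← hξres]
  refine (DiscreteGaloisModule.oneCocycleClass_mem_unramifiedSubgroup_iff_exists
    (GaloisRep.toLocal v ((κ.unitTwist (-1)).eisensteinTwist
      ((W.baseChange K).torsionGaloisModule ((p : ℤ) ^ (k + 1))) hm (k + 1))) ξres).2 ⟨0, fun τ hτ ↦ ?_⟩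
  have h0 : ξres.1 τ = 0 := (hξval τ).trans (hvan τ hτ)
  refine h0.trans ?_
  rw [map_zero, sub_zero]

/-! ## §3 Export: the readout in a `conj_γ`-stable family ⇒ EVERY coordinate class `ι_*[φ_j]` lies in the family -/

/-- **All coordinate classes of a class whose readout lies in a `conj_γ`-stable family lie in that family** (no place, no
reduction hypothesis). For a topological generator `γ` of `κ`, a `conj_γ`-stable subgroup `𝒮 ≤ H¹(K_∞, E[p^∞])`, a 1-cocycle
`ξ` of `T^{(k)} = E[p^{k+1}] ⊗ A_{m,k+1}(ψ⁻¹)` with coordinate cocycles `φ_j(h) = λ([π_j^*] ξ(h))` on `H = ker κ`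
(`exists_coordCocycles`): if the readout of `[ξ]` lies in `𝒮` then `ι_*[φ_j] ∈ 𝒮` for EVERY `j < m` (`ι : E[p^{k+1}] ↪ E[p^∞]`)
— the readout is `(-1)^k • ι_*[φ_{m−1}]` and `ι_*⁻¹ 𝒮` is `conj_γ`-stable (§1). With `𝒮 = Sel_{p^∞}(E/K_∞)`: every coordinate
class of a class whose readout is Selmer over `K_∞` is itself Selmer over `K_∞` (so satisfies the local condition of
`Sel_{p^∞}(E/K_∞)` at EVERY place — the common first step of the place-wise inputs of Howard's Prop. 2.2.8, second map).
[cite: Howard2004HeegnerKolyvagin, §2.2, Lemma 2.2.7 / Prop. 2.2.8 and proof of Thm. 2.2.10 (𝔮 = T^m + p)]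
[cite: GreenbergLNM1716, §4 pp. 107, 124] -/
theorem resH1Hom_inclusion_coord_mem_of_eisensteinTowerReadout_mem {γ : absoluteGaloisGroup K}
    (hγ : κ.IsTopGenerator γ) (𝒮 : AddSubgroup ((W.baseChange K).subgroupH1 p κ.kerSubgroup))
    (h𝒮γ : ∀ s ∈ 𝒮, (W.baseChange K).conjH1 p κ.kerSubgroup γ s ∈ 𝒮) (k : ℕ)
    (ξ : contOneCocycles
      ((κ.unitTwist (-1)).eisensteinTwist ((W.baseChange K).torsionGaloisModule ((p : ℤ) ^ (k + 1))) hm (k + 1)).toTopRep)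
    (φ : Fin m → contOneCocycles (discreteTopRep κ.kerSubgroup (geomTorsion (W.baseChange K) ((p : ℤ) ^ (k + 1)))))
    (hφ : ∀ (j : Fin m) (h : κ.kerSubgroup), (φ j).1 h =
      Twisted.tailReadout p hm (k + 1) (fun b ↦ (W.baseChange K).geomTorsion_pow_nsmul_eq_zero p (k + 1) b)
        (EisensteinCoeff.dualFamily p hm (k + 1) j • ξ.1 (h : absoluteGaloisGroup K)))
    (hc : letI := IwasawaAlgebra.isLocalRing_quotient_X_pow_add_C p hm
      W.eisensteinTowerReadout κ hm π e hkill hker hπ he hπX hek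
        (AddCommGroup.DirectLimit.of _ _ k
          (oneCocycleClass ((κ.unitTwist (-1)).eisensteinTwist
            ((W.baseChange K).torsionGaloisModule ((p : ℤ) ^ (k + 1))) hm (k + 1)).toTopRep ξ :
            galoisCohomology ((κ.unitTwist (-1)).eisensteinTwist
              ((W.baseChange K).torsionGaloisModule ((p : ℤ) ^ (k + 1))) hm (k + 1)) 1) :
          AdicTower.H1A (W.eisensteinTower (κ.unitTwist (-1)) hm) π e hkill hker hπ he) ∈ 𝒮)
    (j : Fin m) :
    resH1Hom (ContinuousMonoidHom.id κ.kerSubgroup)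
        (AddSubgroup.inclusion (AcSigned.geomTorsion_zpow_le_geomPrimaryTorsion (W.baseChange K) p (k + 1)))
        (fun _ _ ↦ rfl) (oneCocycleClass _ (φ j)) ∈ 𝒮 := by
  letI := IwasawaAlgebra.isLocalRing_quotient_X_pow_add_C p hm
  have hlast : m - 1 < m := Nat.sub_lt (lt_of_lt_of_le zero_lt_one hm) zero_lt_one
  -- the readout of `[ξ]` is `(-1)^k • ι_* [φ_{m-1}]`
  have hread : W.eisensteinTowerReadout κ hm π e hkill hker hπ he hπX hek
      (AddCommGroup.DirectLimit.of _ _ k (oneCocycleClass ((κ.unitTwist (-1)).eisensteinTwist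
        ((W.baseChange K).torsionGaloisModule ((p : ℤ) ^ (k + 1))) hm (k + 1)).toTopRep ξ :
          galoisCohomology ((κ.unitTwist (-1)).eisensteinTwist
            ((W.baseChange K).torsionGaloisModule ((p : ℤ) ^ (k + 1))) hm (k + 1)) 1) :
        AdicTower.H1A (W.eisensteinTower (κ.unitTwist (-1)) hm) π e hkill hker hπ he) =
      ((-1 : ℤ) ^ k) • resH1Hom (ContinuousMonoidHom.id κ.kerSubgroup)
        (AddSubgroup.inclusion (AcSigned.geomTorsion_zpow_le_geomPrimaryTorsion (W.baseChange K) p (k + 1)))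
        (fun _ _ ↦ rfl) (oneCocycleClass _ (φ ⟨m - 1, hlast⟩)) := by
    rw [WeierstrassCurve.eisensteinTowerReadout, ZpExtension.eisensteinTowerReadout_of,
      ZpExtension.eisensteinTowerLevelMap_apply,
      (κ.unitTwist (-1)).eisensteinTwistLevelReadout_oneCocycleClass hm (k + 1) _ _ _ κ _ _ ξ φ hφ]
  -- `ι_*⁻¹ 𝒮` is `conj_γ`-stable and contains `[φ_{m-1}]`
  have h𝒮M : ∀ s ∈ 𝒮.comap (resH1Hom (ContinuousMonoidHom.id κ.kerSubgroup)
      (AddSubgroup.inclusion (AcSigned.geomTorsion_zpow_le_geomPrimaryTorsion (W.baseChange K) p (k + 1)))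
      (fun _ _ ↦ rfl)),
      Literature.NumberTheory.EllipticCurves.conjH1 κ.kerSubgroup (geomTorsion (W.baseChange K) ((p : ℤ) ^ (k + 1))) γ s ∈
        𝒮.comap (resH1Hom (ContinuousMonoidHom.id κ.kerSubgroup)
          (AddSubgroup.inclusion (AcSigned.geomTorsion_zpow_le_geomPrimaryTorsion (W.baseChange K) p (k + 1)))
          (fun _ _ ↦ rfl)) := by
    intro s hs
    rw [AddSubgroup.mem_comap] at hs ⊢
    rw [W.resH1Hom_inclusion_conjH1 κ γ (k + 1)]
    exact h𝒮γ _ hs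
  have hlastmem : oneCocycleClass _ (φ ⟨m - 1, hlast⟩) ∈ 𝒮.comap (resH1Hom (ContinuousMonoidHom.id κ.kerSubgroup)
      (AddSubgroup.inclusion (AcSigned.geomTorsion_zpow_le_geomPrimaryTorsion (W.baseChange K) p (k + 1)))
      (fun _ _ ↦ rfl)) := by
    rw [AddSubgroup.mem_comap]
    have h2 := 𝒮.zsmul_mem hc ((-1 : ℤ) ^ k)
    rw [hread, smul_smul, ← mul_pow, neg_mul_neg, one_mul, one_pow, one_smul] at h2
    exact h2
  exact (κ.unitTwist (-1)).oneCocycleClass_coord_mem_of_last_mem hm (k + 1)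
    ((κ.unitTwist (-1)).eisensteinTwistChar hm (k + 1)) ((W.baseChange K).torsionGaloisModule ((p : ℤ) ^ (k + 1)))
    (fun σ y ↦ (κ.unitTwist (-1)).eisensteinTwist_torsionGaloisModule_apply hm (k + 1) (W.baseChange K) _ σ y) κ
    (fun b ↦ (W.baseChange K).geomTorsion_pow_nsmul_eq_zero p (k + 1) b)
    (fun _ hσ ↦ κ.eisensteinTwistChar_unitTwist_eq_one_of_mem_kerSubgroup hm (k + 1) (-1) hσ)
    (κ.eisensteinTwistChar_unitTwist_neg_one_mul_onePlusT hm (k + 1) hγ) ξ φ hφ _ h𝒮M hlastmem j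

end WeierstrassCurve
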